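import Summits.QuantumFields.BalabanUV.T4Continuum.Support.ShellMeasureHaarHausdorffSUN
import Summits.QuantumFields.BalabanUV.T4Continuum.Support.ShellMeasureExpDuhamelDetSUN
import Summits.QuantumFields.BalabanUV.T4Continuum.Support.ShellMeasureRegularConeSUN
import Summits.QuantumFields.BalabanUV.T4Continuum.Support.ShellMeasureRealizedSUN
import Summits.QuantumFields.BalabanUV.T4Continuum.Support.ShellMeasureExpInjectiveSUN
import Literature.Analysis.Calculus.AreaFormulaHausdorff

/-!
# `T4Continuum.ShellMeasureExpHaarAreaSUN` — (CH)₁ FOR `SU(N)`, EVERY `N`, EVERY WINDOW `S < π`: THE ONE-BOND CHART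
# IDENTITY `Haar_{SU(N)} ⌞ exp(B̄_S) = expPtSU_* (vol ⌞ B̄_S · κ_N · expJacSU)` PROVED, and the `SU(N)` realized (M1)
# engine with its located binder `hCH` SUPPLIED
# (cell `pub-balaban`, sub-cell `t4`, spine estimate NE7c (node U5b); ROUND-2 crew `t4-ne7c-formalise-*`; row S3 «SM-L9 SU(N)
# chart» (c5: optional and last) — GAPS G-ne7cL04-1 «(CH)₁ NOT in Mathlib or the tree for N ≥ 3» is DISCHARGED by this
# file; the (CH)₁ LINE = STEP 1 `ShellMeasureExpDuhamelSUN` (leaf-08-g6: the Duhamel chart operator `duhT v` and the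
# left-trivialised derivative `hasFDerivAt_coe_expPtSU`) + STEP 2 `ShellMeasureDuhamelHadamardSUN`/`ShellMeasureExpDuhamelDetSUN`
# (leaf-09-g6: `det T_v = expJacSU v` off the non-regular cone, `0 < det T_v` on `‖v‖ < π`) + the HAUSDORFF ROUTE of
# this seat `b2b-balaban-t4-ne7c-formalise-leaf-10` (gen 5): (H) `ShellMeasureHaarHausdorffSUN` (Haar = normalised
# `d_N`-dimensional Hausdorff measure), (RC) `ShellMeasureRegularConeSUN` (the non-regular cone is null) and THIS assembly
# by the AREA FORMULA; tree target `Summits/QuantumFields/BalabanUV/T4Continuum/Support/`; ADDITIVE — imports those files,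
# S3 f5 `ShellMeasureRealizedSUN` (the engine), S3 f6 `ShellMeasureExpInjectiveSUN` (`expPtSU_injOn`) and the tree's
# `Literature.Analysis.Calculus.AreaFormulaHausdorff` (Federer 3.2.3/3.2.5 in positive codimension); modifies nothing)

HONEST FRAMING.  Finite four-torus programme, rung (B)+1 only — NOT infinite volume, NOT a mass gap, NOT the Clay
problem, NOT summit progress.  Nothing of [Balaban 1983–89] is mentioned or asserted.  What lands is CLASSICAL: the
Haar measure of `SU(N)` in exponential coordinates (Helgason, *Groups and Geometric Analysis*, Ch. I §5 / Weyl's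
Jacobian `∏_{α>0} sinc²(α(X)/2)` — a LOCATOR for the folklore, not a citation tag; everything is kernel-proved here and in
the imported files).  The cell wall of NE7c — (M1) FOR BAŁABAN'S INDUCTIVELY DEFINED EFFECTIVE MEASURES at live levels ⇐
SM-L1/SM-L4/SM-L6 + node U1b's rate — is NOT PRINTED (GAPS G-ne7cp1-1) and is NOT moved by this file: row S3 is the
optional `SU(N)` road, `SU(2)` stays the row's certified instance, and a discharged (CH)₁ changes NOTHING in the countdown
(spine PROVED 0/9).  The result reads «(M1) for the realized `SU(N)` law ⇐ (S-i)/(S-ii) + the data every member carries»,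
never «NE7c proved».  [folklore], 0 sorry, 0 citations, no `def … : Prop` (data defs `DexpM`, `jacM`, `kappaSU`).
HONEST DEPENDENCY (cell, verbatim): continuum YM on T⁴ ⇐ BetaPertH ∧ nine spine estimates (0/9 proved); BetaPertH ⇐ (D1) ∧
(D4) ∧ CAP+tail; G-an2-4 gates asym, D1 and NE2/3/4.

THE POINTS.
* §1 DERIVATIVE: `D expM_v = e^{genSU v} · genSUL ∘ T_v` (`DexpM`; STEP 1's `hasFDerivAt_coe_expPtSU` BY NAME), continuous
  in `v` (`expM` is `C¹`, (H)), INJECTIVE for `‖v‖ < π` (STEP 2's `det_pos_of_norm_lt_pi` + Mathlib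
  `LinearMap.equivOfDetNeZero` + STEP 1's `injective_chartDeriv_of_injective`).
* §2 AREA FORMULA: with `J v := normDet (D expM_v)` (Mathlib `LinearMap.normDet` for the Hilbert–Schmidt inner product of
  (H), `hsInnerProductSpace`; measurable), for every `S < π` (injectivity window of `expPtSU`, S3 f6)
  `expM_* (J · vol ⌞ B̄_S) = μHE[d_N] ⌞ expM(B̄_S)` on `M_N(ℂ)` (`map_expM_withDensity_jacM`, the tree's
  `map_withDensity_normDet_eq_euclideanHausdorffMeasure` BY NAME) and, transported along the measurable embedding
  `SU(N) ↪ M_N(ℂ)` (`hausdorff_image_val` of (H)), `expPtSU_* (J · vol ⌞ B̄_S) = hausdorffSU ⌞ expBallSU S`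
  (`map_expPtSU_withDensity_jacM`).
* §3 with (H)'s `Haar = (hausdorffSU univ)⁻¹ • hausdorffSU` and `κ_N := (hausdorffSU univ)⁻¹` (`kappaSU`, `≠ 0`, `≠ ∞`):
  `Haar ⌞ expBallSU S = expPtSU_* (vol ⌞ B̄_S · κ_N · J)` (`haar_restrict_expBallSU_eq_map_jacM`).
* §4 THE JACOBIAN IS `expJacSU`, A.E.: the BRIDGE `J(v) = |det T_v|` (`jacM_eq_abs_det`: left multiplication by the unitary
  `e^{genSU v}` and the embedding `genSUL` are Hilbert–Schmidt ISOMETRIES — `LinearMap.normDet_comp` ×2,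
  `LinearIsometry.normDet_eq_one` ×2, `normDet_eq_abs_det`); STEP 2's `det_eq_expJacSU` off the non-regular cone + `det ≥ 0`
  give `J(v) = expJacSU v` there (`jacM_eq_expJacSU_of_regular`), and (RC)'s `ae_disc_herm_re_ne_zero` makes it an a.e.
  identity (`jacM_ae_eq_expJacSU`).
* §5 **(CH)₁** `haar_restrict_expBallSU (hS : S < π) : (HaarData.haar : Measure (SUN N)).restrict (expBallSU S) =
  (((volume : Measure (ChartSU N)).restrict (closedBall 0 S)).withDensity (expJacWeightSU (kappaSU N))).map expPtSU` —
  S3 f5's binder VERBATIM with `κ := kappaSU N` — and **`slotAntiConcentration_realized_suN`** = S3 f5's engine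
  `slotAntiConcentration_realized_suN_expJac` with `hCH` SUPPLIED: for `0 ≤ S < π` the `SU(N)` engine asks for nothing
  beyond what the `SU(2)` engine asks ((S-i) `hcore`, (S-ii) `hden`, window factorisation, per-section finiteness).
  (S3 f5 allows `S ≤ π`; the end-point `S = π` — where `expPtSU` stops being injective on the sphere — is not needed by any
  consumer, the window radius being a small parameter, and is left out.)

WHAT THIS DOES NOT DO.  Nothing at live levels of Bałaban's flow; (S-i)/(S-ii) for the localized minimisers; (Det),
(FI-sat), (LR), (MR), (W1), the (F∞)-rate keep their status; NE7c NOT proved.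
-/

noncomputable section

namespace Summit.QuantumFields.BalabanUV.T4Continuum.ShellMeasureExpHaarAreaSUN

open MeasureTheory Measure Set Metric Function Filter Topology
open scoped ENNReal NNReal Matrix Matrix.Norms.Frobenius
open Literature.MathematicalPhysics.QuantumFieldTheory.Balaban1983to89
open T4AdjointCovarianceUnitary (lieSU expSU mem_lieSU_iff coe_expSU)
open ShellMeasureExpChartSUN ShellMeasureExpJacobianSUN ShellMeasureHaarHausdorffSUN
open ShellMeasureScalingSUN (expBallSU)
open ShellMeasureExpDuhamelSUN (genSUL genSUL_apply duhT genSU_duhT_eq_integral hasFDerivAt_coe_expPtSU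
  injective_chartDeriv_of_injective)
open ShellMeasureExpDuhamelDetSUN (det_eq_expJacSU det_pos_of_norm_lt_pi det_mem_Icc)

variable {N : ℕ}

/-! ## §1 The derivative of the ambient chart (STEP 1) is injective inside the `π`-ball (STEP 2) -/

section Derivative

/-- THE DERIVATIVE OF THE AMBIENT CHART `expM = exp ∘ genSU` at `v`, LEFT-TRIVIALISED: `h ↦ e^{genSU v} · genSU (T_v h)`
with STEP 1's Duhamel chart operator `T_v = duhT v` (`ShellMeasureExpDuhamelSUN.hasFDerivAt_coe_expPtSU`). [folklore] -/
def DexpM (v : ChartSU N) : ChartSU N →L[ℝ] MatC N :=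
  (ContinuousLinearMap.mul ℝ (MatC N) (NormedSpace.exp (genSU v))).comp (genSUL.comp (duhT v))

/-- **`expM` HAS DERIVATIVE `DexpM v` AT `v`** (STEP 1 by name). [folklore] -/
theorem hasFDerivAt_expM (v : ChartSU N) : HasFDerivAt (expM (N := N)) (DexpM v) v :=
  hasFDerivAt_coe_expPtSU v

/-- `fderiv ℝ expM v = DexpM v`. [folklore] -/
theorem fderiv_expM (v : ChartSU N) : fderiv ℝ (expM (N := N)) v = DexpM v := (hasFDerivAt_expM v).fderiv

/-- `v ↦ fderiv ℝ expM v` is continuous (`expM` is `C¹`). [folklore] -/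
theorem continuous_fderiv_expM : Continuous fun v : ChartSU N => fderiv ℝ (expM (N := N)) v :=
  (contDiff_expM (N := N) (n := 1)).continuous_fderiv one_ne_zero

/-- **THE DUHAMEL CHART OPERATOR IS INJECTIVE FOR `‖v‖ < π`** (STEP 2: `0 < det T_v`). [folklore] -/
theorem injective_duhT {v : ChartSU N} (hv : ‖v‖ < Real.pi) : Injective (duhT v) := by
  have hdet : LinearMap.det (duhT v : ChartSU N →ₗ[ℝ] ChartSU N) ≠ 0 :=
    (det_pos_of_norm_lt_pi hv _ (genSU_duhT_eq_integral v)).ne'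
  exact (LinearMap.equivOfDetNeZero _ hdet).injective

/-- **THE DERIVATIVE OF THE AMBIENT CHART IS INJECTIVE FOR `‖v‖ < π`.** [folklore] -/
theorem injective_fderiv_expM {v : ChartSU N} (hv : ‖v‖ < Real.pi) : Injective (fderiv ℝ (expM (N := N)) v) := by
  rw [fderiv_expM]
  exact injective_chartDeriv_of_injective (injective_duhT hv)

end Derivative

/-! ## §2 The area formula: the chart image of the Jacobian-weighted Lebesgue measure is the Hausdorff measure -/

section Area

/-- THE CHART-SIDE JACOBIAN DENSITY `J v = normDet (D expM_v)` (Mathlib's `LinearMap.normDet` = `√det(AᵀA)` for the real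
Hilbert–Schmidt inner product — Federer's `d_N`-dimensional Jacobian of the injective differential). [folklore] -/
def jacM (v : ChartSU N) : ℝ≥0∞ :=
  letI : InnerProductSpace ℝ (MatC N) := hsInnerProductSpace
  ENNReal.ofReal (fderiv ℝ (expM (N := N)) v : ChartSU N →ₗ[ℝ] MatC N).normDet

/-- the Jacobian density is measurable (continuity of `fderiv` and of `normDet`). [folklore] -/
theorem measurable_jacM : Measurable (jacM (N := N)) := by
  letI : InnerProductSpace ℝ (MatC N) := hsInnerProductSpace
  exact ENNReal.measurable_ofReal.comp
    (Literature.Analysis.Calculus.continuous_normDet.comp continuous_fderiv_expM).measurable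

/-- `expM` is one-to-one on the closed ball of radius `S < π` (`ShellMeasureExpInjectiveSUN.expPtSU_injOn`). [folklore] -/
theorem injOn_expM {S : ℝ} (hS : S < Real.pi) : InjOn (expM (N := N)) (closedBall 0 S) :=
  fun _ hv _ hw hvw => ShellMeasureExpInjectiveSUN.expPtSU_injOn hS hv hw (Subtype.ext hvw)

/-- the inclusion `SU(N) ↪ M_N(ℂ)` is a measurable embedding. [folklore] -/
theorem measurableEmbedding_val : MeasurableEmbedding (Subtype.val : SUN N → MatC N) :=
  (Topology.IsClosedEmbedding.subtypeVal (isCompact_iff_compactSpace.mpr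
    (inferInstanceAs (CompactSpace (SUN N)))).isClosed).measurableEmbedding

/-- **THE AREA FORMULA FOR THE EXPONENTIAL CHART**: for `S < π`, the image under `expM = exp ∘ genSU` of
`J · vol ⌞ B̄_S` is `μHE[d_N] ⌞ expM(B̄_S)` (Federer 3.2.3/3.2.5 in the tree:
`Literature.Analysis.Calculus.map_withDensity_normDet_eq_euclideanHausdorffMeasure`). [folklore] -/
theorem map_expM_withDensity_jacM {S : ℝ} (hS : S < Real.pi) :
    Measure.map (expM (N := N)) (((volume : Measure (ChartSU N)).restrict (closedBall 0 S)).withDensity jacM) =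
      (μHE[dimSU N] : Measure (MatC N)).restrict (expM '' closedBall (0 : ChartSU N) S) := by
  letI : InnerProductSpace ℝ (MatC N) := hsInnerProductSpace
  have h := Literature.Analysis.Calculus.map_withDensity_normDet_eq_euclideanHausdorffMeasure
    (s := closedBall (0 : ChartSU N) S) (f := expM (N := N)) (f' := fun v => fderiv ℝ (expM (N := N)) v)
    measurableSet_closedBall (fun v _ => (hasFDerivAt_expM v).hasFDerivWithinAt.congr_fderiv (fderiv_expM v).symm)
    (fun v hv => injective_fderiv_expM (lt_of_le_of_lt (mem_closedBall_zero_iff.mp hv) hS)) (injOn_expM hS)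
    continuous_expM.measurable
  rw [finrank_euclideanSpace_fin] at h
  exact h

/-- **THE AREA FORMULA ON THE GROUP**: for `S < π`, the chart image of `J · vol ⌞ B̄_S` under `expPtSU` is the
Hausdorff measure of `SU(N)` restricted to the image window `expBallSU S`. [folklore] -/
theorem map_expPtSU_withDensity_jacM {S : ℝ} (hS : S < Real.pi) :
    Measure.map (expPtSU (N := N)) (((volume : Measure (ChartSU N)).restrict (closedBall 0 S)).withDensity jacM) =
      (hausdorffSU N).restrict (expBallSU S) := by
  have hval := measurableEmbedding_val (N := N)
  ext t ht
  have hpre : expPtSU ⁻¹' t = expM (N := N) ⁻¹' (Subtype.val '' t) := by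
    rw [show expM (N := N) = Subtype.val ∘ expPtSU from rfl, preimage_comp,
      preimage_image_eq _ Subtype.val_injective]
  rw [Measure.map_apply measurable_expPtSU ht, hpre,
    ← Measure.map_apply continuous_expM.measurable (hval.measurableSet_image.mpr ht), map_expM_withDensity_jacM hS,
    Measure.restrict_apply (hval.measurableSet_image.mpr ht), Measure.restrict_apply ht, image_expM,
    ← image_inter Subtype.val_injective, hausdorff_image_val]
  rfl

/-! ## §3 (CH)₁ with the Jacobian `normDet`: `Haar ⌞ expBallSU S = expPtSU_* (vol ⌞ B̄_S · κ_N · J)` -/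

variable (N) in
/-- THE NORMALISING CONSTANT `κ_N = (μHE[d_N] (SU N))⁻¹` (finite and non-zero). [folklore] -/
def kappaSU : ℝ≥0∞ := (hausdorffSU N univ)⁻¹

/-- `κ_N ≠ ∞`. [folklore] -/
theorem kappaSU_ne_top : kappaSU N ≠ ∞ := ENNReal.inv_ne_top.mpr hausdorffSU_univ_pos.ne'

/-- `κ_N ≠ 0`. [folklore] -/
theorem kappaSU_ne_zero : kappaSU N ≠ 0 := ENNReal.inv_ne_zero.mpr hausdorffSU_univ_lt_top.ne

variable [NeZero N]

/-- **(CH)₁ WITH THE `normDet` JACOBIAN, EVERY `N`, EVERY `S < π`.** [folklore] -/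
theorem haar_restrict_expBallSU_eq_map_jacM {S : ℝ} (hS : S < Real.pi) :
    (HaarData.haar : Measure (SUN N)).restrict (expBallSU S) =
      Measure.map expPtSU (((volume : Measure (ChartSU N)).restrict (closedBall 0 S)).withDensity
        fun v => kappaSU N * jacM v) := by
  have hsmul : (fun v => kappaSU N * jacM (N := N) v) = kappaSU N • jacM := rfl
  rw [hsmul, withDensity_smul _ measurable_jacM, Measure.map_smul, map_expPtSU_withDensity_jacM hS,
    haar_eq_smul_hausdorffSU, Measure.restrict_smul]
  rfl

end Area

/-! ## §4 The Jacobian IS `expJacSU`, almost everywhere: BRIDGE (isometries) + STEP 2 (det) + the null cone -/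

section Jacobian

/-- left multiplication by `exp (genSU v) ∈ SU(N)` preserves the Hilbert–Schmidt norm. [folklore] -/
theorem norm_exp_genSU_mul (v : ChartSU N) (A : MatC N) : ‖NormedSpace.exp (genSU v) * A‖ = ‖A‖ :=
  norm_unitary_mul (Matrix.mem_specialUnitaryGroup_iff.mp (expPtSU v).2).1 A

/-- **THE BRIDGE `J(v) = |det T_v|`**: left multiplication by the unitary `e^{genSU v}` and the embedding `genSUL` are
Hilbert–Schmidt isometries, so the `normDet`-Jacobian of `D expM_v = e^{genSU v} · genSUL ∘ T_v` is `|det T_v|`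
(`LinearMap.normDet_comp`, `LinearIsometry.normDet_eq_one`, `LinearMap.normDet_eq_abs_det`). [folklore] -/
theorem jacM_eq_abs_det (v : ChartSU N) :
    jacM v = ENNReal.ofReal |LinearMap.det (duhT v : ChartSU N →ₗ[ℝ] ChartSU N)| := by
  letI : InnerProductSpace ℝ (MatC N) := hsInnerProductSpace
  unfold jacM
  congr 1
  let L : MatC N →ₗᵢ[ℝ] MatC N :=
    { toLinearMap := ((ContinuousLinearMap.mul ℝ (MatC N) (NormedSpace.exp (genSU v)) : MatC N →L[ℝ] MatC N) :
        MatC N →ₗ[ℝ] MatC N)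
      norm_map' := fun A => norm_exp_genSU_mul v A }
  set t : ChartSU N →ₗ[ℝ] ChartSU N := (duhT v : ChartSU N →ₗ[ℝ] ChartSU N) with ht
  have h1 : (L.toLinearMap.domRestrict (LinearMap.range ((genSUli (N := N)).toLinearMap ∘ₗ t))).normDet = 1 :=
    (L.comp (LinearMap.range ((genSUli (N := N)).toLinearMap ∘ₗ t)).subtypeₗᵢ).normDet_eq_one
  have h2 : ((genSUli (N := N)).toLinearMap.domRestrict (LinearMap.range t)).normDet = 1 :=
    ((genSUli (N := N)).comp (LinearMap.range t).subtypeₗᵢ).normDet_eq_one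
  rw [fderiv_expM]
  change (L.toLinearMap ∘ₗ ((genSUli (N := N)).toLinearMap ∘ₗ t)).normDet = |LinearMap.det t|
  rw [LinearMap.normDet_comp, LinearMap.normDet_comp, ← LinearMap.normDet_eq_abs_det, h1, h2, one_mul, one_mul]

/-- **OFF THE NON-REGULAR CONE, `J(v) = expJacSU v`** (STEP 2's `det T_v = expJacSU v` through the bridge; `det ≥ 0`).
[folklore] -/
theorem jacM_eq_expJacSU_of_regular {v : ChartSU N} (hreg : (ShellMeasureVandermondeSUN.disc (herm v)).re ≠ 0) :
    jacM v = ENNReal.ofReal (expJacSU v) := by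
  rw [jacM_eq_abs_det, det_eq_expJacSU hreg _ (genSU_duhT_eq_integral v), abs_of_nonneg (expJacSU_nonneg v)]

variable [NeZero N]

/-- **`J = expJacSU` LEBESGUE-ALMOST EVERYWHERE** (the non-regular cone is null, `ShellMeasureRegularConeSUN`). [folklore] -/
theorem jacM_ae_eq_expJacSU :
    (jacM (N := N)) =ᵐ[volume] fun v => ENNReal.ofReal (expJacSU v) := by
  filter_upwards [ShellMeasureRegularConeSUN.ae_disc_herm_re_ne_zero (N := N)] with v hv
  exact jacM_eq_expJacSU_of_regular hv

/-! ## §5 (CH)₁ — THE ENGINE'S BINDER `hCH`, DISCHARGED for every `N` and every `S < π`, with `κ = κ_N` -/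

/-- **(CH)₁ FOR `SU(N)`, UNCONDITIONALLY**: for every `N ≥ 1` and every window radius `S < π`,
`Haar_{SU(N)} ⌞ expBallSU S = expPtSU_* (vol ⌞ B̄_S · expJacWeightSU κ_N)` — LITERALLY the binder `hCH` of
`ShellMeasureRealizedSUN.slotAntiConcentration_realized_suN_expJac` with `κ := kappaSU N`.  Assembly: (H) Haar =
normalised Hausdorff (`haar_eq_smul_hausdorffSU`), the AREA FORMULA (§2), STEP 1 (the chart derivative), STEP 2
(`det T_v = expJacSU v` off the cone) and the cone's nullity. [folklore] -/
theorem haar_restrict_expBallSU {S : ℝ} (hS : S < Real.pi) :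
    (HaarData.haar : Measure (SUN N)).restrict (expBallSU S) =
      (((volume : Measure (ChartSU N)).restrict (closedBall 0 S)).withDensity (expJacWeightSU (kappaSU N))).map
        expPtSU := by
  rw [haar_restrict_expBallSU_eq_map_jacM hS]
  congr 1
  refine withDensity_congr_ae ?_
  filter_upwards [ae_restrict_of_ae (jacM_ae_eq_expJacSU (N := N))] with v hv
  rw [hv, expJacWeightSU]

/-- **THE `SU(N)` REALIZED (M1) ENGINE WITH (CH)₁ SUPPLIED**: S3 f5's `slotAntiConcentration_realized_suN_expJac` with
`κ := κ_N` and its located binder `hCH` DISCHARGED by `haar_restrict_expBallSU` — beyond the `SU(2)` road the `SU(N)`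
engine now asks for NOTHING but the data every member carries ((S-i) `hcore`, (S-ii) `hden`, the window factorisation,
per-section finiteness); window radius `0 ≤ S < π`. [folklore] -/
theorem slotAntiConcentration_realized_suN {P : Params} {j : ℕ} [DecidableEq (PBond P j)]
    (Λ : Finset (PBond P j)) {S : ℝ} (hS : 0 ≤ S) (hSπ : S < Real.pi)
    (c : GaugeField P j (SUN N) → GaugeField P j (SUN N))
    {R : GaugeField P j (SUN N) → (↥Λ → SUN N) → ℝ≥0∞} (hR : ∀ V, Measurable (R V))
    {F : GaugeField P j (SUN N) → ℝ≥0∞} (hF : Measurable F)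
    (hFw : ∀ V y, F (updateFinset V Λ y) = ShellMeasureScalingSUN.windowSU Λ (c V) S y * R V y)
    (hfin : ∀ V, ((T4ShellMeasureDet.blockLaw Λ).withDensity fun y => F (updateFinset V Λ y)) univ ≠ ∞)
    {u : GaugeField P j (SUN N) → ℝ} (hu : Measurable u) {θ ρ a Bf D : ℝ} (hθ : 0 ≤ θ) (hρ : 0 ≤ ρ) (ha : 0 ≤ a)
    (haD : ((Λ.card * dimSU N : ℕ) + Bf) * a ≤ D * ρ)
    (hcore : ∀ V x, x ∈ closedBall (0 : BlockChartSU N Λ) S → R V (expFibreChartSU Λ (c V) x) ≠ 0 →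
      u (updateFinset V Λ (expFibreChartSU Λ (c V) x)) < θ →
      u (updateFinset V Λ (expFibreChartSU Λ (c V) (Real.exp (-a) • x))) < θ * (1 - ρ))
    (hden : ∀ V x, x ∈ closedBall (0 : BlockChartSU N Λ) S → R V (expFibreChartSU Λ (c V) x) ≠ 0 →
      u (updateFinset V Λ (expFibreChartSU Λ (c V) x)) < θ →
      R V (expFibreChartSU Λ (c V) x) ≤
        ENNReal.ofReal (Real.exp (Bf * a)) * R V (expFibreChartSU Λ (c V) (Real.exp (-a) • x))) :
    T4ShellMeasure.SlotAntiConcentration ((fieldMeasure P j (SUN N)).withDensity F) u θ ρ D :=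
  ShellMeasureRealizedSUN.slotAntiConcentration_realized_suN_expJac Λ hS hSπ.le (kappaSU N)
    (haar_restrict_expBallSU hSπ) c hR hF hFw hfin hu hθ hρ ha haD hcore hden

end Jacobian

end Summit.QuantumFields.BalabanUV.T4Continuum.ShellMeasureExpHaarAreaSUN

end
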